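import Summits.NavierStokesRegularity.NavierStokesRegularity.Theorems.ScenarioCensusTemporalSpectrum
import Summits.NavierStokesRegularity.NavierStokesRegularity.Theorems.ScenarioCensusModeRankShell
import HarnessLib

/-!
# LINE «temporal-spectrum» port, part 2/12: the exponential row `Row_A1ex` / `row_A1ex_holds` (§D), the nilpotent stratum `Row_A1po` / `row_A1po_holds` (§E), the OPEN head
# `Row_A1qp` (§F), nesting: the head implies the faces (§G)

Re-homed for the scenario census (typer seat ns-census-typer-1 g8; the cells A1ex / A1po are MEMBERS OF RECORD «DECIDED IN KERNEL IN FILES» of row A1apT since census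
v1.69 and A1jb / A1cs / A1qx / A1cx since v1.71 (critic idea-crit-3 g6 PASS — no price 20:33:05Z, RE-STAMPs REV 2 → REV 3 → REV 4 22:13:50Z; ref ns-census-ref g8
PRE-CHECK ✓ §13.14 item 11 + items 19/20; lit §21.21 / §21.24 (a)); this port makes them TREE-decided): VERBATIM PORT of ns-idea-2 LINE g12-2 «temporal-spectrum»
REV 4, `pub/ideators/ns-idea-2/lines/temporal-spectrum/line-temporal-spectrum.lean` sha16 f2331f3a0765e1d4 (3431 l., lean check rc 0, 0 sorry), split for the
400-line rule into twelve parts `ScenarioCensusTemporalSpectrum{∅, Exponential, Oscillatory, OscillatoryRow, Jordan, Complex, ComplexDecay, ComplexRow, Quasi, QuasiGroup,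
QuasiRow, Head}` (chain imports).  Lean text VERBATIM in namespace `…Theorems.ScenarioCensus.TemporalSpectrum` (the line's `…Lines.TemporalSpectrum` re-homed);
port edits: the two `local notation "E3"` lines → one `abbrev E3` at namespace level and the bracket lines `section Rows` / `end Rows` dropped (no `variable`s
there; typer lint: no notation in port files), `@[conjecture]` on the OPEN head `Row_A1qp` (typed only), twenty-one one-line docstrings added (gate lint); the
lemmas the line shares VERBATIM with «mode-rank» / «floquet-meter» (§B spatial Liouville lemmas, the instrument `vortB` / `vortB_sum_sum`, the gauge
`tendsto_slice_atBot` / `eq_zero_of_curl_slice_const`, `laplacian_zero_apply`, `norm_curl_le_four_mul`) are taken BY NAME from those landed ports (listed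
below); `tendsto_typeI_bound` (twin of a landed tree lemma in a module the farm does not build) is not re-declared and its four uses carry the one-line
Mathlib proof inline (proof text only).  Statements untouched.

No census VALUE is moved here (row A1apT keeps its value; the members become TREE-decided by name); NS regularity is NOT proved; (L′) ⟨10661⟩ is
untouched; no summit statement is proved by this file. Lemmas that restate already-landed tree declarations are taken BY NAME (gate lint `dedup.landed`): `apply_eq_apply_of_harmonic_bounded` = `ModeRank.apply_eq_apply_of_harmonic_bounded`, `apply_eq_apply_of_curl_const` = `ModeRank.apply_eq_apply_of_curl_const`, `nonpos_of_laplacian_eq_mul` = `ModeRank.nonpos_of_laplacian_eq_mul`, `eq_zero_of_laplacian_eq_smul_of_pos` = `ModeRank.eq_zero_of_laplacian_eq_smul_of_pos`, `vortB` = `ModeRank.vortB`, `vortB_sum_sum` = `ModeRank.vortB_sum_sum`, `tendsto_slice_atBot` = `ModeRank.tendsto_slice_atBot`, `eq_zero_of_curl_slice_const` = `ModeRank.eq_zero_of_curl_slice_const`, `laplacian_zero_apply` = `ModeRank.laplacian_zero_fun`, `norm_curl_le_four_mul` = `FloquetMeter.norm_curl_le_four_mul`.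
-/

-- the summit and its single problem share the name `NavierStokesRegularity` (D-0017 nested layout)
set_option linter.dupNamespace false

noncomputable section

open Set Function Filter Topology

namespace Summit.NavierStokesRegularity.NavierStokesRegularity.Theorems.ScenarioCensus.TemporalSpectrum

open Literature.Analysis Literature.Analysis.FluidPDE InnerProductSpace
open Summit.NavierStokesRegularity.NavierStokesRegularity.Theorems (vorticity_eq_deriv_of_typeI)
open scoped Laplacian InnerProductSpace RealInnerProductSpace ContDiff

/-! ## D. The exponential row -/

/-- **Row A1ex (real simple temporal spectrum)** — census A-block cell, (L′)-shape over the genuine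
class `IsTypeIAncientMild C u` BY NAME: if on `t < 0` the field is a finite sum of EXPONENTIAL time
modes with distinct real rates and `C³` spatial coefficients with bounded curls,
`u(t, x) = ∑ₖ e^{σₖ t} φₖ(x)`, then `u ≡ 0` on `t < 0`.  No shell, closure, symmetry, periodicity or
integrability hypothesis. -/
def Row_A1ex : Prop :=
  ∀ (C : ℝ) (u : ℝ → E3 → E3), IsTypeIAncientMild C u →
  ∀ (n : ℕ) (σ : Fin n → ℝ) (φ : Fin n → E3 → E3), Function.Injective σ →
    (∀ k, ContDiff ℝ 3 (φ k)) → (∀ k, ∃ A : ℝ, ∀ x, ‖curl (φ k) x‖ ≤ A) →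
    (∀ t < 0, ∀ x, u t x = ∑ k, Real.exp (σ k * t) • φ k x) →
    ∀ t < 0, ∀ x, u t x = 0

/-- **Row A1ex holds** (sorry-free). -/
theorem row_A1ex_holds : Row_A1ex := by
  classical
  intro C u hu n σ φ hσ hφ hbd hsl
  have hcφ : ∀ k, ContDiff ℝ 2 (curl (φ k)) := fun k => contDiff_curl (hφ k)
  have hdφ : ∀ k, Differentiable ℝ (φ k) := fun k => (hφ k).differentiable (by norm_num)
  have hsm : IsSmoothSpaceTimeOn (Iio 0) u := hu.contDiffOn
  -- ### Step 1: modes with non-positive rate vanish (Type-I decay at `-∞` + dominant balance)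
  have hneg : ∀ k, σ k ≤ 0 → ∀ x, φ k x = 0 := by
    intro k hk x
    have hlim : Tendsto (fun t : ℝ => ∑ j, Real.exp (σ j * t) • φ j x) atBot (𝓝 0) := by
      refine (ModeRank.tendsto_slice_atBot hu x).congr' ?_
      filter_upwards [Iio_mem_atBot (0 : ℝ)] with t ht
      exact hsl t ht x
    have key := sum_filter_eq_zero_of_tendsto σ (fun j => φ j x) hlim (σ k) hk
    have hfk : Finset.univ.filter (fun i => σ i = σ k) = {k} := by
      ext i
      simp only [Finset.mem_filter, Finset.mem_univ, true_and, Finset.mem_singleton]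
      exact hσ.eq_iff
    rwa [hfk, Finset.sum_singleton] at key
  -- ### Step 2: the vorticity identity along the exponential modes
  have hslF : ∀ s < 0, u s = fun y => ∑ k, Real.exp (σ k * s) • φ k y :=
    fun s hs => funext (hsl s hs)
  have hcurl : ∀ s < 0, curl (u s) = fun y => ∑ k, Real.exp (σ k * s) • curl (φ k) y := by
    intro s hs; funext y; rw [hslF s hs]; exact curl_sum_smul hdφ _ y
  have hE : ∀ t < 0, ∀ x,
      ∑ k, Real.exp (σ k * t) • (σ k • curl (φ k) x - (Δ (curl (φ k))) x)
        + ∑ i, ∑ j, (Real.exp (σ i * t) * Real.exp (σ j * t)) • ModeRank.vortB (φ i) (curl (φ j)) x = 0 := by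
    intro t ht x
    have h2 := vorticity_eq_deriv_of_typeI hu ht x
    have hd : deriv (fun s => curl (u s) x) t = ∑ k, (Real.exp (σ k * t) * σ k) • curl (φ k) x := by
      have hev : (fun s => curl (u s) x) =ᶠ[𝓝 t] fun s => ∑ k, Real.exp (σ k * s) • curl (φ k) x := by
        filter_upwards [Iio_mem_nhds ht] with s hs
        rw [hcurl s hs]
      rw [hev.deriv_eq]
      exact (hasDerivAt_expSum σ (fun k => curl (φ k) x) t).deriv
    have hB : fderiv ℝ (curl (u t)) x (u t x) - fderiv ℝ (u t) x (curl (u t) x)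
        = ∑ i, ∑ j, (Real.exp (σ i * t) * Real.exp (σ j * t)) • ModeRank.vortB (φ i) (curl (φ j)) x := by
      have := ModeRank.vortB_sum_sum φ (fun j => curl (φ j)) (fun i => Real.exp (σ i * t))
        (fun j => Real.exp (σ j * t)) (x := x) (fun l => hdφ l x)
        (fun j => (hcφ j).differentiable (by norm_num) x)
      rw [hcurl t ht, hslF t ht]
      simpa only [ModeRank.vortB] using this
    have hL : (Δ (curl (u t))) x = ∑ k, Real.exp (σ k * t) • (Δ (curl (φ k))) x := by
      rw [hcurl t ht]; exact laplacian_sum_smul hcφ _ x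
    -- assemble
    have h3 : deriv (fun s => curl (u s) x) t
        + (fderiv ℝ (curl (u t)) x (u t x) - fderiv ℝ (u t) x (curl (u t) x))
        - (Δ (curl (u t))) x = 0 := by rw [← sub_eq_zero.2 h2]; abel
    rw [hd, hB, hL] at h3
    have h4 : ∑ k, Real.exp (σ k * t) • (σ k • curl (φ k) x - (Δ (curl (φ k))) x)
        = ∑ k, (Real.exp (σ k * t) * σ k) • curl (φ k) x
          - ∑ k, Real.exp (σ k * t) • (Δ (curl (φ k))) x := by
      simp only [smul_sub, smul_smul, Finset.sum_sub_distrib]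
    rw [h4, sub_add_eq_add_sub]
    exact h3
  -- ### Step 3: every mode is curl-free (minimal positive rate ⇒ positive Laplace shell ⇒ 0)
  have hnotAll : ∀ k, curl (φ k) = 0 := by
    by_contra hne
    push Not at hne
    obtain ⟨k0, hk0⟩ := hne
    set S : Finset (Fin n) := Finset.univ.filter (fun k => curl (φ k) ≠ 0) with hS
    have hSne : S.Nonempty := ⟨k0, by simp [hS, hk0]⟩
    obtain ⟨ks, hks, hmin⟩ := S.exists_min_image σ hSne
    have hks' : curl (φ ks) ≠ 0 := (Finset.mem_filter.1 hks).2
    have hnotS : ∀ j, σ j < σ ks → curl (φ j) = 0 := by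
      intro j hj
      by_contra hj'
      exact absurd (hmin j (Finset.mem_filter.2 ⟨Finset.mem_univ _, hj'⟩)) (not_le.2 hj)
    have hpos : 0 < σ ks := by
      by_contra hle
      push Not at hle
      apply hks'
      have h0 : φ ks = 0 := funext fun y => hneg ks hle y
      funext y
      rw [h0]
      exact curl_zero y
    -- the dominant-balance identity at the rate `σ ks`
    have hgrp : ∀ x, σ ks • curl (φ ks) x - (Δ (curl (φ ks))) x = 0 := by
      intro x
      let ν : Fin n ⊕ (Fin n × Fin n) → ℝ := Sum.elim σ (fun p => σ p.1 + σ p.2)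
      let Cf : Fin n ⊕ (Fin n × Fin n) → E3 :=
        Sum.elim (fun k => σ k • curl (φ k) x - (Δ (curl (φ k))) x)
          (fun p => ModeRank.vortB (φ p.1) (curl (φ p.2)) x)
      have hsum : ∀ t < 0, ∑ m, Real.exp (ν m * t) • Cf m = 0 := by
        intro t ht
        rw [Fintype.sum_sum_type, Fintype.sum_prod_type]
        simp only [ν, Cf, Sum.elim_inl, Sum.elim_inr, add_mul, Real.exp_add]
        exact hE t ht x
      have key := sum_filter_eq_zero_of_eq_zero ν Cf hsum (σ ks)
      rw [Finset.sum_filter, Fintype.sum_sum_type] at key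
      have hinl : ∑ k : Fin n, (if ν (Sum.inl k) = σ ks then Cf (Sum.inl k) else 0)
          = σ ks • curl (φ ks) x - (Δ (curl (φ ks))) x := by
        simp only [ν, Cf, Sum.elim_inl, hσ.eq_iff, Finset.sum_ite_eq', Finset.mem_univ, if_true]
      have hinr : ∑ p : Fin n × Fin n,
          (if ν (Sum.inr p) = σ ks then Cf (Sum.inr p) else 0) = 0 := by
        refine Finset.sum_eq_zero fun p _ => ?_
        split_ifs with hp
        · simp only [ν, Sum.elim_inr] at hp
          simp only [Cf, Sum.elim_inr]
          rcases le_or_gt (σ p.1) 0 with h1 | h1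
          · have h0 : φ p.1 = 0 := funext fun y => hneg p.1 h1 y
            rw [h0]
            exact vortB_zero_left _ x
          · have h2 : σ p.2 < σ ks := by linarith
            rw [hnotS p.2 h2]
            exact vortB_zero_right _ x
        · rfl
      rw [hinl, hinr, add_zero] at key
      exact key
    obtain ⟨A, hA⟩ := hbd ks
    have hzero : curl (φ ks) = 0 := by
      funext x
      exact ModeRank.eq_zero_of_laplacian_eq_smul_of_pos (hcφ ks) hpos
        (fun y => (sub_eq_zero.1 (hgrp y)).symm) hA x
    exact hks' hzero
  -- ### Step 4: curl-free slices ⇒ zero (KNSS gauge)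
  refine ModeRank.eq_zero_of_curl_slice_const hu fun t ht => ⟨0, fun x => ?_⟩
  rw [hcurl t ht]
  simp [hnotAll]

/-! ## E. The nilpotent stratum (rate 0 with a Jordan block): polynomial time dependence -/

/-- `-e^{-τ} → -∞` as `τ → -∞`. -/
theorem tendsto_neg_exp_neg_atBot :
    Tendsto (fun τ : ℝ => -Real.exp (-τ)) atBot atBot :=
  tendsto_neg_atTop_atBot.comp (Real.tendsto_exp_atTop.comp tendsto_neg_atBot_atTop)

/-- **Row A1po (polynomial time dependence)** — display cell of bookkeeping weight: if on `t < 0`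
the field is a polynomial in `t` with spatial coefficient fields, `u(t, x) = ∑_{m<n} t^m φₘ(x)`, then
`u ≡ 0`.  Only the Type-I decay at `-∞` is used (no PDE): the substitution `t = -e^{-τ}` turns the
monomials into exponential modes of rates `-m ≤ 0`, all killed by `sum_filter_eq_zero_of_tendsto`. -/
def Row_A1po : Prop :=
  ∀ (C : ℝ) (u : ℝ → E3 → E3), IsTypeIAncientMild C u →
  ∀ (n : ℕ) (φ : Fin n → E3 → E3),
    (∀ t < 0, ∀ x, u t x = ∑ m : Fin n, t ^ (m : ℕ) • φ m x) →
    ∀ t < 0, ∀ x, u t x = 0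

/-- **Row A1po holds** (sorry-free). -/
theorem row_A1po_holds : Row_A1po := by
  classical
  intro C u hu n φ hsl
  have hcoef : ∀ m : Fin n, ∀ x, φ m x = 0 := by
    intro m x
    -- pull back along `t = -e^{-τ}`
    have hlim : Tendsto (fun τ : ℝ => ∑ j : Fin n,
        Real.exp ((-(j : ℕ) : ℝ) * τ) • ((-1 : ℝ) ^ (j : ℕ) • φ j x)) atBot (𝓝 0) := by
      have h1 := (ModeRank.tendsto_slice_atBot hu x).comp tendsto_neg_exp_neg_atBot
      refine h1.congr' (Eventually.of_forall fun τ => ?_)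
      have hneg : -Real.exp (-τ) < 0 := neg_neg_of_pos (Real.exp_pos _)
      simp only [Function.comp_apply]
      rw [hsl _ hneg x]
      refine Finset.sum_congr rfl fun j _ => ?_
      rw [smul_smul, neg_eq_neg_one_mul, mul_pow, ← Real.exp_nat_mul]
      congr 1
      rw [mul_comm]
      congr 1
      congr 1
      ring
    have key := sum_filter_eq_zero_of_tendsto (fun j : Fin n => (-(j : ℕ) : ℝ))
      (fun j => ((-1 : ℝ) ^ (j : ℕ) • φ j x)) hlim (-(m : ℕ) : ℝ)
      (by simp only [Left.neg_nonpos_iff]; exact Nat.cast_nonneg _)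
    have hfk : Finset.univ.filter (fun j : Fin n => (-(j : ℕ) : ℝ) = -(m : ℕ)) = {m} := by
      ext j
      simp only [Finset.mem_filter, Finset.mem_univ, true_and, Finset.mem_singleton, neg_inj,
        Nat.cast_inj]
      exact Fin.val_inj
    rw [hfk, Finset.sum_singleton] at key
    have hpow : ((-1 : ℝ) ^ (m : ℕ)) ≠ 0 := pow_ne_zero _ (by norm_num)
    exact (smul_eq_zero.1 key).resolve_left hpow
  intro t ht x
  rw [hsl t ht x]
  simp [hcoef]

/-! ## F. The open head: arbitrary finite temporal spectrum -/

/-- **Row A1qp (finite temporal spectrum; OPEN head, typed only)** — if at every point `x` the time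
signal `t ↦ u(t, x)` is annihilated on `t < 0` by ONE monic constant-coefficient differential operator
`L(∂ₜ) = ∂ₜⁿ + ∑_{m<n} c_m ∂ₜ^m` (the same for all `x`), then `u ≡ 0`.  Equivalently the slices are
quasi-polynomials in `t` (finitely many complex rates, Jordan blocks allowed) with spatial coefficient
fields.  The cells decided here are the REAL SIMPLE spectrum (`Row_A1ex`), the nilpotent block at
rate 0 (`Row_A1po`), (REV 2, §H) ONE OSCILLATORY PAIR `a ± ib` (`Row_A1cx`), and (REV 3, §J, §K, §Q) the
Jordan cell `Row_A1jb`, the complex simple spectrum `Row_A1cs` and the FULL EXPLICIT QUASI-POLYNOMIAL CELL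
`Row_A1qx` (all finite complex spectra with Jordan blocks, in explicit real form, profiles `C³` with bounded
curls).  What this operator-form head adds to `Row_A1qx` is only the REPRESENTATION step (the solutions of
`L(∂ₜ)v = 0` on `t < 0`, pointwise in `x`, form an explicit real quasi-polynomial family whose coefficient
fields are fixed linear combinations of finitely many slices) and a sup bound on the curls of the slices of
the class — constant-coefficient ODE solution bases are not in Mathlib and the line has not typed them, so
`Row_A1qp → Row_A1qx` is not claimed and the head stays OPEN as typed. -/
@[conjecture] def Row_A1qp : Prop :=
  ∀ (C : ℝ) (u : ℝ → E3 → E3), IsTypeIAncientMild C u →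
  ∀ (n : ℕ) (c : Fin n → ℝ),
    (∀ x, ∀ t < 0, iteratedDeriv n (fun s => u s x) t
        + ∑ m : Fin n, c m • iteratedDeriv (m : ℕ) (fun s => u s x) t = 0) →
    ∀ t < 0, ∀ x, u t x = 0

/-- Bookkeeping: the two decided temporal-spectrum cells of this line. -/
theorem temporalSpectrum_cells_decided : Row_A1ex ∧ Row_A1po := ⟨row_A1ex_holds, row_A1po_holds⟩

/-! ## G. Nesting: the open head implies the exponential face -/

/-- Iterated time derivatives of an exponential mode sum. -/
theorem iteratedDeriv_expSum {n : ℕ} (σ : Fin n → ℝ) (v : Fin n → E3) (m : ℕ) :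
    iteratedDeriv m (fun s => ∑ k, Real.exp (σ k * s) • v k)
      = fun s => ∑ k, (σ k ^ m * Real.exp (σ k * s)) • v k := by
  induction m with
  | zero => funext s; simp [iteratedDeriv_zero]
  | succ m IH =>
    rw [iteratedDeriv_succ, IH]
    funext s
    have : HasDerivAt (fun s => ∑ k, (σ k ^ m * Real.exp (σ k * s)) • v k)
        (∑ k, (σ k ^ (m + 1) * Real.exp (σ k * s)) • v k) s := by
      refine HasDerivAt.fun_sum fun k _ => ?_
      have h1 : HasDerivAt (fun s => σ k * s) (σ k) s := by
        simpa using (hasDerivAt_id s).const_mul (σ k)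
      have h2 : HasDerivAt (fun s => σ k ^ m * Real.exp (σ k * s))
          (σ k ^ m * (Real.exp (σ k * s) * σ k)) s := h1.exp.const_mul _
      have h3 := h2.smul_const (v k)
      convert h3 using 2
      ring
    exact this.deriv

/-- **Nesting.** The open head `Row_A1qp` implies the decided face `Row_A1ex`: an exponential mode sum with
rates `σₖ` is annihilated by the companion operator `∏ₖ (∂ₜ - σₖ)`, whose coefficients are those of the
monic polynomial `∏ₖ (X - σₖ)`. -/
theorem row_A1ex_of_row_A1qp (h : Row_A1qp) : Row_A1ex := by
  classical
  intro C u hu n σ φ hσ hφ hbd hsl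
  let p : Polynomial ℝ := ∏ k, (Polynomial.X - Polynomial.C (σ k))
  have hmon : p.Monic :=
    Polynomial.monic_prod_of_monic _ _ fun k _ => Polynomial.monic_X_sub_C _
  have hdeg : p.natDegree = n := by
    show (∏ k, (Polynomial.X - Polynomial.C (σ k))).natDegree = n
    rw [Polynomial.natDegree_prod_of_monic _ _ fun k _ => Polynomial.monic_X_sub_C _]
    simp
  have heval : ∀ k, p.eval (σ k) = 0 := by
    intro k
    show Polynomial.eval (σ k) (∏ j, (Polynomial.X - Polynomial.C (σ j))) = 0
    rw [Polynomial.eval_prod]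
    exact Finset.prod_eq_zero (Finset.mem_univ k) (by simp)
  have hlt : p.natDegree < n + 1 := by rw [hdeg]; exact Nat.lt_succ_self n
  have hexp : ∀ k, ∑ i ∈ Finset.range (n + 1), p.coeff i * σ k ^ i = 0 := by
    intro k
    rw [← Polynomial.eval_eq_sum_range' hlt, heval k]
  have htop : p.coeff n = 1 := by rw [← hdeg]; exact hmon.coeff_natDegree
  refine h C u hu n (fun m => p.coeff m) fun x t ht => ?_
  have hev : (fun s => u s x) =ᶠ[𝓝 t] fun s => ∑ k, Real.exp (σ k * s) • φ k x := by
    filter_upwards [Iio_mem_nhds ht] with s hs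
    exact hsl s hs x
  have hD : ∀ m : ℕ, iteratedDeriv m (fun s => u s x) t
      = ∑ k, (σ k ^ m * Real.exp (σ k * t)) • φ k x := by
    intro m
    rw [hev.iteratedDeriv_eq m, iteratedDeriv_expSum]
  have hsum : ∑ i ∈ Finset.range (n + 1), p.coeff i • iteratedDeriv i (fun s => u s x) t = 0 := by
    simp_rw [hD, Finset.smul_sum, smul_smul]
    rw [Finset.sum_comm]
    refine Finset.sum_eq_zero fun k _ => ?_
    rw [← Finset.sum_smul]
    have h1 : ∑ i ∈ Finset.range (n + 1), p.coeff i * (σ k ^ i * Real.exp (σ k * t))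
        = (∑ i ∈ Finset.range (n + 1), p.coeff i * σ k ^ i) * Real.exp (σ k * t) := by
      rw [Finset.sum_mul]
      exact Finset.sum_congr rfl fun i _ => by ring
    rw [h1, hexp k, zero_mul, zero_smul]
  rw [Finset.sum_range_succ, htop, one_smul] at hsum
  rw [Fin.sum_univ_eq_sum_range (fun i => p.coeff i • iteratedDeriv i (fun s => u s x) t) n, add_comm]
  exact hsum

/-- Iterated time derivatives of a polynomial mode sum. -/
theorem iteratedDeriv_polySum {n : ℕ} (v : Fin n → E3) (k : ℕ) :
    iteratedDeriv k (fun s : ℝ => ∑ m : Fin n, s ^ (m : ℕ) • v m)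
      = fun s => ∑ m : Fin n, (((m : ℕ).descFactorial k : ℝ) * s ^ ((m : ℕ) - k)) • v m := by
  induction k with
  | zero => funext s; simp [iteratedDeriv_zero]
  | succ k IH =>
    rw [iteratedDeriv_succ, IH]
    funext s
    have : HasDerivAt (fun s : ℝ => ∑ m : Fin n, (((m : ℕ).descFactorial k : ℝ) * s ^ ((m : ℕ) - k)) • v m)
        (∑ m : Fin n, (((m : ℕ).descFactorial (k + 1) : ℝ) * s ^ ((m : ℕ) - (k + 1))) • v m) s := by
      refine HasDerivAt.fun_sum fun m _ => ?_
      have h2 : HasDerivAt (fun s : ℝ => ((m : ℕ).descFactorial k : ℝ) * s ^ ((m : ℕ) - k))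
          (((m : ℕ).descFactorial k : ℝ) * ((((m : ℕ) - k : ℕ) : ℝ) * s ^ ((m : ℕ) - k - 1))) s :=
        (hasDerivAt_pow _ s).const_mul _
      have h3 := h2.smul_const (v m)
      convert h3 using 2
      rw [Nat.descFactorial_succ, Nat.sub_sub, Nat.cast_mul]
      ring
    exact this.deriv

/-- **Nesting.** The open head `Row_A1qp` implies the polynomial face `Row_A1po` (`L = ∂ₜⁿ`). -/
theorem row_A1po_of_row_A1qp (h : Row_A1qp) : Row_A1po := by
  classical
  intro C u hu n φ hsl
  refine h C u hu n (fun _ => 0) fun x t ht => ?_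
  have hev : (fun s => u s x) =ᶠ[𝓝 t] fun s => ∑ m : Fin n, s ^ (m : ℕ) • φ m x := by
    filter_upwards [Iio_mem_nhds ht] with s hs
    exact hsl s hs x
  rw [hev.iteratedDeriv_eq n, iteratedDeriv_polySum]
  simp only [zero_smul, Finset.sum_const_zero, add_zero]
  refine Finset.sum_eq_zero fun m _ => ?_
  have hm : (m : ℕ).descFactorial n = 0 := Nat.descFactorial_eq_zero_iff_lt.2 m.isLt
  rw [hm, Nat.cast_zero, zero_mul, zero_smul]

/-- Bookkeeping: the head contains both decided faces. -/
theorem faces_of_row_A1qp (h : Row_A1qp) : Row_A1ex ∧ Row_A1po :=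
  ⟨row_A1ex_of_row_A1qp h, row_A1po_of_row_A1qp h⟩

end Summit.NavierStokesRegularity.NavierStokesRegularity.Theorems.ScenarioCensus.TemporalSpectrum

end
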